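import Mathlib.MeasureTheory.Measure.Portmanteau
import Literature.Probability.RandomPlanarGeometry.CurveSpace
import Literature.Probability.RandomPlanarGeometry.SelfAvoidingWalk
import Summits.CriticalPhenomena.SAWScalingLimit.Theorems.SubseqIdentification.Negative.Necessity
import Summits.CriticalPhenomena.SAWScalingLimit.Theorems.SubseqIdentification.Negative.ProbabilityRedundant
import HarnessLib

/-!
# `stub_latticeAreaLawOfLimitLaw`: the lattice area law S4 from a FULL weak limit with the
# two-sided `r²` law (portmanteau along the mesh filter; converse of S5)

Stub N2 of the necessity package of the line `boundary-area-law` for the crux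
`SubseqIdentification` (stmt-CriticalPhenomena-0783, route `SAWRenewalTightness`; primary decl
`SAWParafermion.SubseqIdentification`; lead c3, cycle 1).

Statement. Let `(D; a, b)` be a Dobrushin domain with an endpoint approximation `(a_δ, b_δ)` and
suppose the critical `δℤ²` SAW laws, pushed to `CurveClass ℂ` by `γ ↦ γ.curve`, converge weakly
(test-function form) along the WHOLE mesh filter `𝓝[>] 0` to a probability measure `μ` which
satisfies the two-sided boundary area law at `x₀`: `c r² ≤ μ[dist(x₀, trace) < r]` and
`μ[dist(x₀, trace) ≤ r] ≤ C r²` for `0 < r ≤ r₀`. Then the registered LATTICE area law S4 holds at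
`x₀`: with `ε₀ := r₀` and one constant `C'`, for every `0 < r ≤ ε₀`, eventually in `δ → 0⁺`,
`P_δ(≤ r) ε₀² ≤ C' P_δ(≤ ε₀) r²` and `P_δ(≤ ε₀) r² ≤ C' P_δ(≤ r) ε₀²` (cross-multiplied in `ℝ≥0∞`).

Proof (portmanteau on the Polish `CurveClass ℂ`, along the filter `𝓝[>] 0`). Past the junk meshes
the laws are probability measures (`Negative.eventually_isProbabilityMeasure_law`); the family of
image laws, completed by `μ` at the junk meshes, is a `ProbabilityMeasure`-valued function
converging to `μ` (`ProbabilityMeasure.tendsto_iff_forall_integral_tendsto`, `integral_map`). The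
functional `c ↦ dist(x₀, trace c)` is `1`-Lipschitz, so `{dist ≤ r}` is closed, `{dist < r}` open,
and (`ProbabilityMeasure.limsup_measure_closed_le_of_tendsto`,
`ProbabilityMeasure.le_liminf_measure_open_of_tendsto`, `eventually_lt_of_limsup_lt`,
`eventually_lt_of_lt_liminf`) eventually `P_δ(≤ r) < 2 C r²`, `P_δ(< ε₀) > c ε₀²/2`,
`P_δ(< r) > c r²/2`; with `P_δ ≤ 1` the two inequalities follow for `C' = 4C/c + 2/(c ε₀²)`.

This is the converse direction of the landed S5 `stub_areaLawOfLimit` (lattice law along a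
sequence ⇒ continuum law of the subsequential limit); together with N1 (the SLE_{8/3} law has the
two-sided `r²` law at a flat window) and N3 it gives `SAW.SAWScalingLimit → S4`: the lattice stub
of the line is implied by the Lawler–Schramm–Werner conjecture as typed.
No named fact is used; axioms `propext`, `Classical.choice`, `Quot.sound`.
-/

noncomputable section

open MeasureTheory Filter Topology Set
open scoped NNReal ENNReal BoundedContinuousFunction

namespace Summit.CriticalPhenomena.SAWScalingLimit.Theorems.SubseqIdentification.BoundaryAreaLaw

open Literature.Probability.RandomPlanarGeometry Literature.Probability.LatticeModels

/-- `c ↦ dist(x₀, trace c)` is `1`-Lipschitz for the reparametrisation distance on curve classes: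
every point of one trace is within `dist c₁ c₂` of the other trace (`Curve.infDist_range_le`).
[folklore] -/
private theorem lipschitzWith_infDist_range (z : ℂ) :
    LipschitzWith 1 fun c : CurveClass ℂ => Metric.infDist z c.range := by
  -- adapted from `Literature.Barriers.CriticalPhenomena.SupercriticalSAW.lipschitzWith_infDist_range`
  refine LipschitzWith.of_le_add fun c₁ c₂ => ?_
  obtain ⟨γ₁, rfl⟩ := CurveClass.surjective_mk c₁
  obtain ⟨γ₂, rfl⟩ := CurveClass.surjective_mk c₂
  simp only [CurveClass.range_mk, CurveClass.dist_mk_mk]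
  have key : ∀ ⦃y⦄, y ∈ γ₂.range → Metric.infDist z γ₁.range - dist γ₁ γ₂ ≤ dist z y := by
    rintro y ⟨t, rfl⟩
    have h₁ := Curve.infDist_range_le γ₂ γ₁ t
    have h₂ := Metric.infDist_le_infDist_add_dist (s := γ₁.range) (x := z) (y := γ₂ t)
    rw [dist_comm γ₂ γ₁] at h₁
    linarith
  have h := (Metric.le_infDist γ₂.range_nonempty).2 key
  linarith

/-- **N2 — THE LATTICE AREA LAW FROM A FULL WEAK LIMIT WITH THE TWO-SIDED `r²` LAW** (registered
stub `stub_latticeAreaLawOfLimitLaw` of the line `boundary-area-law`, crux `SubseqIdentification`,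
stmt-CriticalPhenomena-0783; converse of S5). If the pushed critical SAW laws of `(D; a, b)`
converge weakly along `𝓝[>] 0` to a probability measure `μ` with `c r² ≤ μ[dist(x₀, trace) < r]`
and `μ[dist(x₀, trace) ≤ r] ≤ C r²` for `0 < r ≤ r₀`, then for `ε₀ := r₀`,
`C' := 4C/c + 2/(c ε₀²)` and every `0 < r ≤ ε₀`, eventually in `δ → 0⁺`:
`P_δ(≤ r) ε₀² ≤ C' P_δ(≤ ε₀) r²` and `P_δ(≤ ε₀) r² ≤ C' P_δ(≤ r) ε₀²`. Portmanteau along the mesh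
filter for the closed events `{dist ≤ r}` and the open events `{dist < r}`. [folklore] -/
theorem stub_latticeAreaLawOfLimitLaw :
    ∀ (D : DobrushinDomain) (a b : ℝ → Site 2) (μ : Measure (CurveClass ℂ)) (x₀ : ℂ),
      SAW.IsEndpointApprox D a b → IsProbabilityMeasure μ →
      (∀ f : CurveClass ℂ →ᵇ ℝ,
        Tendsto (fun δ => ∫ γ, f γ.curve ∂(SAW.law D.carrier δ (a δ) (b δ)))
          (𝓝[>] (0 : ℝ)) (𝓝 (∫ x, f x ∂μ))) →
      (∃ c C r₀ : ℝ, 0 < c ∧ 0 < C ∧ 0 < r₀ ∧ ∀ r : ℝ, 0 < r → r ≤ r₀ →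
        ENNReal.ofReal (c * r ^ 2) ≤ μ {γ | Metric.infDist x₀ γ.range < r} ∧
          μ {γ | Metric.infDist x₀ γ.range ≤ r} ≤ ENNReal.ofReal (C * r ^ 2)) →
      ∃ C ε₀ : ℝ, 0 < C ∧ 0 < ε₀ ∧ ∀ r : ℝ, 0 < r → r ≤ ε₀ →
        ∀ᶠ δ in 𝓝[>] (0 : ℝ),
          SAW.law D.carrier δ (a δ) (b δ) {γ | Metric.infDist x₀ γ.curve.range ≤ r} *
              ENNReal.ofReal (ε₀ ^ 2) ≤
            ENNReal.ofReal C *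
              SAW.law D.carrier δ (a δ) (b δ) {γ | Metric.infDist x₀ γ.curve.range ≤ ε₀} *
                ENNReal.ofReal (r ^ 2) ∧
          SAW.law D.carrier δ (a δ) (b δ) {γ | Metric.infDist x₀ γ.curve.range ≤ ε₀} *
              ENNReal.ofReal (r ^ 2) ≤
            ENNReal.ofReal C *
              SAW.law D.carrier δ (a δ) (b δ) {γ | Metric.infDist x₀ γ.curve.range ≤ r} *
                ENNReal.ofReal (ε₀ ^ 2) := by
  intro D a b μ x₀ hab hμ hlim hlaw
  obtain ⟨c, C, r₀, hc, hC, hr₀, hlaw⟩ := hlaw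
  haveI := hμ
  classical
  -- past the junk meshes the SAW laws are probability measures
  have hprob : ∀ᶠ δ in 𝓝[>] (0 : ℝ), IsProbabilityMeasure (SAW.law D.carrier δ (a δ) (b δ)) :=
    Negative.eventually_isProbabilityMeasure_law hab
  -- the image laws as a `ProbabilityMeasure`-valued family (completed by `μ` at the junk meshes)
  let ν : ℝ → ProbabilityMeasure (CurveClass ℂ) := fun δ =>
    if h : IsProbabilityMeasure (SAW.law D.carrier δ (a δ) (b δ)) then
      ⟨(SAW.law D.carrier δ (a δ) (b δ)).map (fun γ => γ.curve), by
        haveI := h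
        exact Measure.isProbabilityMeasure_map (SAW.DomainSAW.measurable_of_top _).aemeasurable⟩
    else ⟨μ, hμ⟩
  have hνeq : ∀ δ, IsProbabilityMeasure (SAW.law D.carrier δ (a δ) (b δ)) →
      ((ν δ : ProbabilityMeasure (CurveClass ℂ)) : Measure (CurveClass ℂ)) =
        (SAW.law D.carrier δ (a δ) (b δ)).map (fun γ => γ.curve) := by
    intro δ h
    simp only [ν, dif_pos h, ProbabilityMeasure.coe_mk]
  have hνapply : ∀ δ, IsProbabilityMeasure (SAW.law D.carrier δ (a δ) (b δ)) →
      ∀ {S : Set (CurveClass ℂ)}, MeasurableSet S →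
        ((ν δ : ProbabilityMeasure (CurveClass ℂ)) : Measure (CurveClass ℂ)) S =
          SAW.law D.carrier δ (a δ) (b δ) ((fun γ => γ.curve) ⁻¹' S) := by
    intro δ h S hS
    rw [hνeq δ h, Measure.map_apply (SAW.DomainSAW.measurable_of_top _) hS]
  -- weak convergence of the family along the mesh filter
  have hνlim : Tendsto ν (𝓝[>] (0 : ℝ)) (𝓝 (⟨μ, hμ⟩ : ProbabilityMeasure (CurveClass ℂ))) := by
    refine ProbabilityMeasure.tendsto_iff_forall_integral_tendsto.2 fun f => ?_
    refine (hlim f).congr' ?_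
    filter_upwards [hprob] with δ hδ
    rw [hνeq δ hδ, integral_map (SAW.DomainSAW.measurable_of_top _).aemeasurable
      f.continuous.aestronglyMeasurable]
  -- the events: `{dist ≤ r}` is closed, `{dist < r}` is open
  have hcont : Continuous fun c : CurveClass ℂ => Metric.infDist x₀ c.range :=
    (lipschitzWith_infDist_range x₀).continuous
  have hclosed : ∀ r : ℝ, IsClosed {c : CurveClass ℂ | Metric.infDist x₀ c.range ≤ r} :=
    fun r => isClosed_le hcont continuous_const
  have hopen : ∀ r : ℝ, IsOpen {c : CurveClass ℂ | Metric.infDist x₀ c.range < r} :=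
    fun r => isOpen_lt hcont continuous_const
  -- portmanteau along `𝓝[>] 0`
  have hlimsup : ∀ r : ℝ,
      limsup (fun δ => ((ν δ : ProbabilityMeasure (CurveClass ℂ)) : Measure (CurveClass ℂ))
        {c | Metric.infDist x₀ c.range ≤ r}) (𝓝[>] (0 : ℝ)) ≤
          μ {c | Metric.infDist x₀ c.range ≤ r} :=
    fun r => ProbabilityMeasure.limsup_measure_closed_le_of_tendsto hνlim (hclosed r)
  have hliminf : ∀ r : ℝ, μ {c | Metric.infDist x₀ c.range < r} ≤
      liminf (fun δ => ((ν δ : ProbabilityMeasure (CurveClass ℂ)) : Measure (CurveClass ℂ))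
        {c | Metric.infDist x₀ c.range < r}) (𝓝[>] (0 : ℝ)) :=
    fun r => ProbabilityMeasure.le_liminf_measure_open_of_tendsto hνlim (hopen r)
  -- eventual one-sided bounds for the lattice probabilities at a fixed radius `0 < r ≤ r₀`
  have hupper : ∀ r : ℝ, 0 < r → r ≤ r₀ → ∀ᶠ δ in 𝓝[>] (0 : ℝ),
      SAW.law D.carrier δ (a δ) (b δ) {γ | Metric.infDist x₀ γ.curve.range ≤ r} ≤
        ENNReal.ofReal (2 * C * r ^ 2) := by
    intro r hr hrr
    have hlt : limsup (fun δ => ((ν δ : ProbabilityMeasure (CurveClass ℂ)) :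
        Measure (CurveClass ℂ)) {c | Metric.infDist x₀ c.range ≤ r}) (𝓝[>] (0 : ℝ)) <
          ENNReal.ofReal (2 * C * r ^ 2) := by
      refine (hlimsup r).trans_lt ((hlaw r hr hrr).2.trans_lt ?_)
      rw [ENNReal.ofReal_lt_ofReal_iff (by positivity)]
      nlinarith [mul_pos hC (pow_pos hr 2)]
    filter_upwards [eventually_lt_of_limsup_lt hlt, hprob] with δ hδ hp
    rw [hνapply δ hp (hclosed r).measurableSet] at hδ
    exact hδ.le
  have hlower : ∀ r : ℝ, 0 < r → r ≤ r₀ → ∀ᶠ δ in 𝓝[>] (0 : ℝ),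
      ENNReal.ofReal (c * r ^ 2 / 2) ≤
        SAW.law D.carrier δ (a δ) (b δ) {γ | Metric.infDist x₀ γ.curve.range ≤ r} := by
    intro r hr hrr
    have hlt : ENNReal.ofReal (c * r ^ 2 / 2) <
        liminf (fun δ => ((ν δ : ProbabilityMeasure (CurveClass ℂ)) :
          Measure (CurveClass ℂ)) {c | Metric.infDist x₀ c.range < r}) (𝓝[>] (0 : ℝ)) := by
      refine lt_of_lt_of_le ?_ ((hlaw r hr hrr).1.trans (hliminf r))
      rw [ENNReal.ofReal_lt_ofReal_iff (by positivity)]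
      nlinarith [mul_pos hc (pow_pos hr 2)]
    filter_upwards [eventually_lt_of_lt_liminf hlt, hprob] with δ hδ hp
    rw [hνapply δ hp (hopen r).measurableSet] at hδ
    refine hδ.le.trans (measure_mono fun γ (hγ : Metric.infDist x₀ γ.curve.range < r) => ?_)
    exact hγ.le
  -- the constants
  set C' : ℝ := 4 * C / c + 2 / (c * r₀ ^ 2) with hC'
  have hC'0 : 0 < C' := by positivity
  have hkey : ∀ r : ℝ, C' * (c * r₀ ^ 2 / 2) * r ^ 2 = 2 * C * r ^ 2 * r₀ ^ 2 + r ^ 2 := by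
    intro r
    rw [hC']
    field_simp
    ring
  have hkey' : ∀ r : ℝ, C' * (c * r ^ 2 / 2) * r₀ ^ 2 = 2 * C * r ^ 2 * r₀ ^ 2 + r ^ 2 := by
    intro r
    rw [hC']
    field_simp
    ring
  refine ⟨C', r₀, hC'0, hr₀, fun r hr hrr => ?_⟩
  filter_upwards [hupper r hr hrr, hlower r hr hrr, hlower r₀ hr₀ le_rfl, hprob]
    with δ hU hL hL₀ hp
  constructor
  · -- `P_δ(≤ r) ε₀² ≤ 2C r² ε₀² ≤ C' (c ε₀²/2) r² ≤ C' P_δ(≤ ε₀) r²`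
    calc SAW.law D.carrier δ (a δ) (b δ) {γ | Metric.infDist x₀ γ.curve.range ≤ r} *
          ENNReal.ofReal (r₀ ^ 2)
        ≤ ENNReal.ofReal (2 * C * r ^ 2) * ENNReal.ofReal (r₀ ^ 2) := by gcongr
      _ = ENNReal.ofReal (2 * C * r ^ 2 * r₀ ^ 2) := by
          rw [← ENNReal.ofReal_mul (by positivity)]
      _ ≤ ENNReal.ofReal (C' * (c * r₀ ^ 2 / 2) * r ^ 2) := by
          refine ENNReal.ofReal_le_ofReal ?_
          rw [hkey r]
          nlinarith [pow_pos hr 2]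
      _ = ENNReal.ofReal C' * ENNReal.ofReal (c * r₀ ^ 2 / 2) * ENNReal.ofReal (r ^ 2) := by
          rw [ENNReal.ofReal_mul (by positivity), ENNReal.ofReal_mul hC'0.le]
      _ ≤ ENNReal.ofReal C' *
            SAW.law D.carrier δ (a δ) (b δ) {γ | Metric.infDist x₀ γ.curve.range ≤ r₀} *
              ENNReal.ofReal (r ^ 2) := by gcongr
  · -- `P_δ(≤ ε₀) r² ≤ r² ≤ C' (c r²/2) ε₀² ≤ C' P_δ(≤ r) ε₀²`
    calc SAW.law D.carrier δ (a δ) (b δ) {γ | Metric.infDist x₀ γ.curve.range ≤ r₀} *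
          ENNReal.ofReal (r ^ 2)
        ≤ 1 * ENNReal.ofReal (r ^ 2) := by
          gcongr
          exact prob_le_one
      _ = ENNReal.ofReal (r ^ 2) := one_mul _
      _ ≤ ENNReal.ofReal (C' * (c * r ^ 2 / 2) * r₀ ^ 2) := by
          refine ENNReal.ofReal_le_ofReal ?_
          rw [hkey' r]
          nlinarith [mul_pos hC (pow_pos hr 2), pow_pos hr₀ 2]
      _ = ENNReal.ofReal C' * ENNReal.ofReal (c * r ^ 2 / 2) * ENNReal.ofReal (r₀ ^ 2) := by
          rw [ENNReal.ofReal_mul (by positivity), ENNReal.ofReal_mul hC'0.le]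
      _ ≤ ENNReal.ofReal C' *
            SAW.law D.carrier δ (a δ) (b δ) {γ | Metric.infDist x₀ γ.curve.range ≤ r} *
              ENNReal.ofReal (r₀ ^ 2) := by gcongr

end Summit.CriticalPhenomena.SAWScalingLimit.Theorems.SubseqIdentification.BoundaryAreaLaw

end
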